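import Mathlib
import HarnessLib
import HarnessLib.Audit
import Summits.BirchSwinnertonDyer.Statement
import Literature.NumberTheory.EllipticCurves.GlobalMinimalModel
import Literature.NumberTheory.EllipticCurves.Selmer
import Literature.NumberTheory.EllipticCurves.Sha
import Literature.NumberTheory.EllipticCurves.Tamagawa
import Literature.NumberTheory.EllipticCurves.GaloisAction
import Literature.NumberTheory.EllipticCurves.Newforms
import Literature.NumberTheory.DiophantineGeometry.Conductor
import Literature.NumberTheory.EllipticCurves.SelmerCorankHolds
import Literature.NumberTheory.EllipticCurves.GlobalMinimalModelProofs
import Literature.NumberTheory.EllipticCurves.MinimalModelReduction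
import Literature.NumberTheory.EllipticCurves.VariableChangePoints
import Literature.NumberTheory.DiophantineGeometry.LocalReductionProofs
import Literature.NumberTheory.DiophantineGeometry.MinimalModelUniquenessProofs
import Literature.NumberTheory.EllipticCurves.OrdinaryPrimesProofs
import Literature.NumberTheory.EllipticCurves.Isogeny
import Summits.BirchSwinnertonDyer.BirchSwinnertonDyer.Theorems.FrozenTwinSerrePrimeSupply
import HarnessLib.Audit.Status.Attr

/-!
Route: ShadowIsolation

# Route ShadowIsolation — a divisible Ш would cast a p-adically convergent shadow of accidental
even-sign zeros; shadows are isolated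

BARRIER INVERSION (operator C). The catalogue says: LB in analytic rank ≥ 2 IS "div Ш(E)[p^∞] = 0 at
one prime" (SelmerRankBarrierNarrow),
no theorem whose output is about Sel_{p^∞}(E) can give it, no point of E may be constructed
(HeegnerPointBarrier), and any analytic
observable must be a VALUE at even sign (FunctionalEquationSeesOnlyParity) whose failure is
certifiable (NumericalVanishingBarrier).
So every route needs an observable EXTERNAL to E's Selmer theory that a divisible phantom triggers
at every depth p^n (sensitivity)
and that cannot be triggered for n ≫ 0 (rigidity). It suffices to show X = (S ∧ I) ∧ SelBSD at every
good ordinary prime p ≥ 5 with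
E[p] irreducible (global minimal model), plus the residual Eisenstein sector R below: S =
PhantomShadow (an element of Ш(E) of exact order p^n forces an ACCIDENTAL zero — an
even-sign newform g ≠ f_E of squarefree level N·M, (M, pN) = 1, congruent to f_E at depth p^n, with
L(g,1) = 0), I =
IsolationOfAccidentalZeros (∃ n₀(E,p): no accidental zero at depth ≥ n₀), hence corank Ш[p^∞] = 0;
SelBSD = corank Sel_{p^∞} = r_an
(items SelmerRankUB / SelmerRankLB / SelmerRankSmallImage, shared verbatim with route SelmerRank); R
= ShaCotorsionReducible (Ш[p^∞]-cotorsion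
at a good ordinary p ≥ 5 where E[p] is REDUCIBLE — a rational p-isogeny, p ∈ {5, 7, 11, 13, 17, 19,
37, 43, 67, 163} — the narrow sector
where the visibility lemma has no grip; rank 7, lowest). Card realised:
sha-divisible-shadow-accidental-zero-isolation (spine; S is the typed consequence of its visibility
statement V, I is its isolation).
Lean: `∀ (W : WeierstrassCurve ℚ) [W.IsElliptic] [W.IsGloballyMinimal] (p : ℕ) [Fact p.Prime], 5 ≤ p
→ W.HasGoodReductionAtPrime p → ¬ (p : ℤ) ∣ W.frobeniusTrace p → W.HasIrreducibleModPGaloisRep p →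
W.shaCorank p = 0 ∧ W.selmerCorank p = W.analyticRank`

## Assembly
Bookkeeping over proved tree theorems, ALL inside the crux-only deciding theorem (certified by the
gate audit on the rendered file:
codes [], axioms propext / Classical.choice / Quot.sound): `closes : IsolationOfAccidentalZeros →
PhantomShadow → SelmerRankUB →
SelmerRankLB → SelmerRankSmallImage → ShaCotorsionReducible → BirchSwinnertonDyer`. Inside it: (A)
Greenberg's finite-group algebra
`zpCorank = 0` for a finite group and (B) "bounded exponent + finite p-torsion ⇒ finite" give the
support item ShaUnboundedOfCorank
(shaCorank ≠ 0 ⇒ Ш-elements of every exact order p^n) as a PROVED lemma; the support glue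
CruxesToTarget gives X (contrapositive: elements
of every order ⇒ accidental zeros at every depth by PhantomShadow, contradicting
IsolationOfAccidentalZeros; Selmer-BSD by the surjective
/ non-surjective case split); the assembly item takes X, R and the three Selmer cruxes to the
Statement: for an arbitrary elliptic W take a
global minimal model C • W (hasGlobalMinimalModel_rat_holds) and a good ordinary p ≥ 5
(exists_good_ordinary_prime_holds, proved in tree);
if E[p] is irreducible X gives shaCorank = 0 and selmerCorank = analyticRank, else R and the image
dichotomy (UB ∧ LB or SmallImage) do;
Greenberg's corank identity (selmerCorank_eq_mordellWeilRank_add_holds) gives rank = r_an on C • W,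
and rank / analytic rank are invariant
under C (AEC III.3.1(b); VII.1.3, VII.2, App. C §16, re-derived inline exactly as in route
SelmerRank's certified `closes`).

Rationale: WHY THIS LINE. Mechanism: Cremona–Mazur visibility run BACKWARDS and to infinite depth. A phantom σ
∈ Ш(E)[p^n] made visible in (E × A_g)/Δ through a
depth-p^n level-raising congruence A_g[𝔓^m] ≅ E[p^n] (Ribet1990, DiamondTaylor1994,
BertoliniDarmon2005 n-admissible primes; JetchevStein2007
Thm 5.1.3 and Conj 7.1.1 at depth 1) is the Kummer class of an honest point of A_g, so rank A_g(ℚ) >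
0 (non-Eisenstein lemma, E[p] irreducible)
and L(g,1) = 0 by Kato2004Asterisque Cor 14.3 with Shimura1977 equivariance — an accidental zero
when the sign of g is kept even. A divisible
Ш would therefore cast an infinite, p-adically convergent shadow of accidental even-sign central
zeros onto f_E, and I says such shadows
are isolated (Vatsal1999 rigidity of algebraic central values under congruences, Galois-orbit growth
Serre1997, positive-proportion
non-vanishing, Howard2007 as the one isolation-type theorem in print, in the Hida direction).
Imported areas: visibility theory and
level-raising (arithmetic of modular Jacobians) for S; analytic non-vanishing of central VALUES in
families for I. What no listed route
does: attack the Ш-gap itself — SelmerRank files Ш[p^∞]-finiteness as a bare crux without mechanism,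
PAdicOrderV2 / HigherGrossZagier /
Squeeze work the analytic gap — and do it without heights, p-adic L-functions, or any construction
of points on E. Negatives index: empty.

RANKED CRUXES. #0 ShadowIsolationThesis (target) — for every elliptic E/ℚ (global minimal model W)
and every good ordinary prime p ≥ 5 with E[p] irreducible: corank_{ℤ_p} Ш(E/ℚ)[p^∞] = 0 and corank
Sel_{p^∞}(E/ℚ) = ord_{s=1} L(E,s). (why it might fail: X ⇒ BSD-rank and Ш[p^∞]-cotorsion at EVERY
such p: fails iff some E has rank ≠ r_an, or a divisible Ш[p^∞] at one good ordinary irreducible p;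
no engine beyond r_an ≤ 1 on either conjunct (BCS2025 Thm 1.1.2; CastellaHsieh2022 Rem 1.3).)
[GreenbergLNM1716, Kato2004Asterisque, SkinnerUrban2014, CremonaMazur2000, JetchevStein2007]
#2 IsolationOfAccidentalZeros (crux) — ISOLATION (card item I). For W globally minimal elliptic, p ≥
5 good ordinary with E[p] irreducible, there is n₀ such that for n ≥ n₀ there is NO newform g on
Γ₀(N_W·M) (M squarefree, (M, p·N_W) = 1), g not the newform of W, with Fricke eigenvalue −1 (even
sign w(g) = +1), whose Hecke eigenvalues a_ℓ(g), ℓ ∤ N_W·M, admit a ring homomorphism ℤ[a_ℓ(g)] →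
ℤ/p^n sending a_ℓ(g) ↦ a_ℓ(W) (depth-n congruence), and whose completed L-function vanishes at the
centre s = 1 (typed, rev 3 cone repair, over Mathlib + Newforms/HeckeOperators only: `not the
newform of W' as a q-expansion mismatch, Fricke eigenvalue −1 as w g = −g for the weight-2
double-coset operator of w = S·diag(N_W·M,1) = (0 −1; N_W·M 0), the central zero as vanishing at s =
1 of the entire continuation of Σ aₙ(g) n^(−s) from re s > 2 — equivalent to the rev-2
CuspFormLFunction typing by Atkin–Lehner and Hecke 1936). [difficulty: open-problem] (why it might
fail: It is a NEW non-vanishing conjecture: nothing known forbids infinitely many even-sign g_n ≡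
f_E (mod p^n) of growing level N·M_n with L(g_n,1) = 0; level-aspect Maeda/orbit growth and
Frey–Mazur finiteness of deep elliptic congruences are open.) [Vatsal1999, Howard2007, Serre1997,
Shimura1977, BertoliniDarmon2005, DiamondTaylor1994]
#3 PhantomShadow (crux) — SHADOW (typed consequence of card item V + C1). Same W, p; for every n ≥
1, if Ш(E/ℚ) has an element of exact order p^n then there IS such an accidental zero at depth n: a
newform g ≠ f_W of level N_W·M (M squarefree, coprime to p·N_W), even sign, depth-n congruent to W
at all ℓ ∤ N_W·M, with Λ(g,1) = 0, typed exactly as the predicate negated in #2 (intended proof: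
sign-kept level raising mod p^n makes σ visible in (E × A_g)/Δ; E[p] irreducible ⇒ rank A_g > 0 ⇒
L(g,1) = 0 by Kato). [difficulty: open-problem] (why it might fail: Visibility of a GIVEN Ш-class is
proved only for orders 2, 3 and by ONE-prime level raising a_ℓ ≡ −(ℓ+1) (JetchevStein2007 Thm
5.1.3), which can flip the sign; no sign-kept depth-n visibility theorem exists even at n = 1, and a
class visible only at odd sign falsifies S.) [CremonaMazur2000, Mazur1999, AgasheStein2002,
JetchevStein2007, Agashe2010, BertoliniDarmon2005, Kato2004Asterisque, arXiv:2601.21519]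
#4 SelmerRankUB (crux) — shared verbatim with route SelmerRank (crux #3 there): for p ≥ 5 good
ordinary with ρ̄_{E,p} surjective (global minimal model), corank Sel_{p^∞}(E/ℚ) ≤ ord_{s=1} L(E,s).
[difficulty: open-problem] (why it might fail: Theorem for corank ≤ 3 (r ≤ 1 converses + p-parity),
OPEN from corank 4; false iff rank > r_an or Ш[p^∞] divisible at a big-image ordinary p; sole handle
Kato 18.4 (corank ≤ ord_T L_p) meets Schneider's conjecture.) [Kato2004Asterisque, GreenbergLNM1716,
SkinnerUrban2014, arXiv:2412.20078]
#5 SelmerRankLB (crux) — shared verbatim with route SelmerRank (crux #4 there): same hypotheses,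
ord_{s=1} L(E,s) ≤ corank Sel_{p^∞}(E/ℚ). [difficulty: open-problem] (why it might fail: Theorem for
r_an ≤ 3 (BCS2025: L(E,1)=0 ⇒ corank ≥ 1; corank 1 ⇒ ord 1; p-parity), OPEN from r_an = 4; needs
Selmer classes out of high-order vanishing, and Heegner points are torsion once r_an ≥ 2.)
[SkinnerUrban2014, Kato2004Asterisque, arXiv:2412.20078, arXiv:2312.01481, WZhang2014]
#6 SelmerRankSmallImage (crux) — shared verbatim with route SelmerRank (crux #6 there): for p ≥ 5
good ordinary with ρ̄_{E,p} NOT surjective (CM, Eisenstein, normaliser-of-Cartan primes), corank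
Sel_{p^∞}(E/ℚ) = ord_{s=1} L(E,s). [deps: SelmerRankUB] [difficulty: open-problem] (why it might
fail: Open from min(corank, r_an) ≥ 2 exactly as UB/LB, and here even rank ≤ 1 is only partly known
— Eisenstein p: IMC / μ = 0 only in GreenbergVatsal2000-type cases; CM: Rubin's main conjecture
gives corank = ord of the Katz p-adic L, not = r_an.) [GreenbergVatsal2000, Mazur1978, Serre1972,
SkinnerUrban2014]
#7 ShaCotorsionReducible (crux) — RESIDUAL EISENSTEIN SECTOR: for W globally minimal elliptic and p
≥ 5 good ordinary with E[p] REDUCIBLE (E admits a rational p-isogeny; p ∈ {5, 7, 13} from X₀(p) of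
genus 0, or finitely many j for p ∈ {11, 17, 19, 37, 43, 67, 163}, Mazur1978), corank_{ℤ_p}
Ш(E/ℚ)[p^∞] = 0. Needed only because the deciding theorem takes its prime from the proved supply
`exists_good_ordinary_prime_holds` (p ≥ 5 good ordinary, possibly Eisenstein) — importing the
cofinite-irreducibility theorem (AEC IX.6.3, ModPIrreducibleCofinite) would put the
Faltings/Shafarevich files into the module cone. [difficulty: open-problem] (why it might fail: It
is Ш[p^∞]-cotorsion at an Eisenstein prime: φ-descent bounds Sel^φ by class groups and units
(GreenbergVatsal2000 for the Iwasawa invariants) but never separates Ш_div from points once r_an ≥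
2, and the visibility lemma has no grip there (rational torsion of the quotient explains
visibility).) [GreenbergVatsal2000, Mazur1978, Mazur1977, CremonaFisherONeilSimonStoll2008,
Literature.Barriers.BirchSwinnertonDyer.SelmerRankBarrier]
#9 ShaUnboundedOfCorank (support) — pure algebra of the tree's `zpCorank` (dim Ш[p] − dim Ш/pШ): if
shaCorank W p ≠ 0 then Ш(W) has elements of exact order p^n for every n (zpCorank ≠ 0 ⇒ Ш[p^∞][p]
finite non-zero ⇒ unbounded exponent, else Ш[p^∞] finite and the two dimensions agree). [difficulty:
provable-now] [Greenberg1999LNM, SilvermanAEC2009]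

#9 CruxesToTarget (support) — the glue cruxes → X: Isolation → Shadow → ShaUnboundedOfCorank →
SelmerRankUB → SelmerRankLB → SelmerRankSmallImage → ShadowIsolationThesis (contrapositive: a
positive Ш-corank gives elements of all orders, Shadow gives accidental zeros at every depth,
contradicting Isolation; Selmer-BSD by the surjective / non-surjective case split). Provable now
(planner Sketch.lean, rc 0). [difficulty: provable-now] [GreenbergLNM1716]

TWO-LAYER PLAN. Foreseen, not filed: PhantomShadow ⇐ DeepVisibility (card V: σ ∈ Ш[p^n] is the image
of a point of A_g under a sign-kept two-prime
level raising mod p^n; needs a modular-abelian-variety notion A_g) → NonEisensteinVisibility (card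
C1: rank A_g = 0 ⇒ no p-power visible
Ш when E[p] is irreducible; with Kato for A_g) → PhantomShadow. IsolationOfAccidentalZeros ⇐
OrbitGrowth (deep congruent newforms have
coefficient-field degree → ∞ / occupy almost all of their Atkin–Lehner class) →
PositiveProportionNonvanishing (uniform in squarefree level)
→ IsolationOfAccidentalZeros. k ≤ 3 each, depth 1.

KILL CRITERIA. An infinite sequence of even-sign newforms g_n ≢ f_E, congruent to f_E at depth p^n,
with L(g_n,1) = 0 for ONE (E, p) refutes
IsolationOfAccidentalZeros and the line (no rigidity left): close
`refuted:IsolationOfAccidentalZeros`. A Ш-element provably without an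
even-sign depth-n shadow refutes PhantomShadow: pivot once to the odd-sign form (shadow = EXCESS
rank of A_g beyond the sign, isolation of
excess zeros), else close. A refutation of SelmerRankUB / LB / SmallImage breaks this route together
with SelmerRank (shared items).
Mooted (superseded) if Ш[p^∞]-cotorsion (SelmerRank#5) is proved by other means or
BirchSwinnertonDyer closes via PAdicOrderV2 /
HigherGrossZagier; a proof of Jetchev–Stein Conj 7.1.1 in sign-kept depth-n form closes
PhantomShadow outright.

NOT DECOMPOSED YET. The abelian-variety layer of S (A_g, the visibility map, Kummer classes on A_g —
card items V and C1; the typed crux is their consequence,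
so no definition request blocks the open); the split of I into orbit growth + positive-proportion
non-vanishing; CM curves (covered by the
uniform irreducibility hypothesis, not separated); p ∈ {2, 3} (never needed: the supply gives p ≥
5); the Eisenstein sector R is one bare crux (φ-descent /
Greenberg–Vatsal shape not decomposed); the Selmer-BSD half (SelmerRankUB/LB/SmallImage are route
SelmerRank's cruxes and are decomposed there).

CHEAPEST FALSIFIER. Lookup (run 2026-08-16, zbMATH legs listed under Novelty): is there a known
infinite family of even-sign newforms congruent to a fixed
f_E at unbounded p-adic depth with vanishing central value? None found — quadratic twists are
excluded (level N·d² is not a squarefree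
coprime level raising), elliptic members of the depth-n class are finite once p^n ≥ 7 (X_E(p^n) has
genus ≥ 2), CM/Eisenstein forms are
excluded by cuspidality + irreducibility. Next cheapest (kit job, not run on the compute-free hub):
depth-1 test of PhantomShadow on
Cremona–Mazur's curves whose Ш[5] or Ш[7] is INVISIBLE at level N (CremonaMazur2000 Table 1):
modular symbols mod p on S₂(Γ₀(N·ℓ₁·ℓ₂)),
ℓ_i 1-admissible, looking for an even-sign congruent newform with L(g,1) = 0; persistent absence up
to moderate ℓ₁ℓ₂ weighs against S.

NUMBERS. Kato2004Asterisque Cor 14.3: L(A_g,1) ≠ 0 ⇒ A_g(ℚ) finite (any weight-2 newform).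
CremonaMazur2000: for rank-0 optimal curves of
conductor < 5500 with non-trivial odd Ш, a congruent curve of rank 2 at level N explains Ш in the
large majority of cases (Table 1 lists
the invisible residue). JetchevStein2007 §6: invisible elements at levels 767 and 959 become visible
at a multiple level. n-admissible
primes have positive density for every n (BertoliniDarmon2005 §2). Items after rev 3: 11 (1 target,
6 cruxes — 2 new + 1 residual + 3 shared with route SelmerRank — 3 support, 1 assembly); module
import cone after rev 3: 75 modules, 1 unproved named fact (hasEntireLFunction_rat, via the
Statement).

DEFINITION REQUESTS. None blocking. Rev 3 (cone repair 2026-08-16): the two lead cruxes are typed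
over Mathlib (CuspForm, Gamma0, qExpansion, LSeries, WeierstrassCurve.LFunction, ModularGroup.S) +
Newforms/HeckeOperators (IsNewform0, heckeEigenvalue, cuspHeckeOperatorₗ, slToGLPos, diagGL) +
conductorNorm, frobeniusTrace, HasGoodReductionAtPrime, HasIrreducibleModPGaloisRep, sha, shaCorank,
selmerCorank — all existing; `Literature.NumberTheory.EllipticCurves.CuspFormLFunction`
(frickeEigenvalue, completedCuspFormLContinuations, IsNewformOf) is deliberately NOT imported
because it vendors the unproved modularity facts exists_isNewformOf / existsUnique_isNewformOf (XL)
into the module cone; the equivalence of the two typings is Atkin–Lehner (w_N-eigenvalue of a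
newform) + Hecke 1936 (entire Λ ⇔ entire L, same zero at s = 1), the Fricke part kernel-checked in
the planner's scratch Equiv.lean. CONE DEBT, genuinely needed and not re-routable — needs-fact:
WeierstrassCurve.hasEntireLFunction_rat (Literature/NumberTheory/EllipticCurves/AnalyticRank.lean;
it enters through Summits/BirchSwinnertonDyer/BirchSwinnertonDyer/Statement.lean itself —
analyticRank := analyticOrderNatAt entireLFunction 1 is a junk value without it — so it lies in the
cone of every route of the summit; in tree it is modularity:
hasEntireLFunction_rat_of_exists_isNewformOf, AnalyticRankModularityProofs). Proof-level (not cone)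
dependences provers should expect: PhantomShadow conditional on exists_isNewformOf (f_W exists), on
Ribet1990 / DiamondTaylor1994 level raising and on Kato Cor 14.3 for A_g, none vendored; the layer-2
child DeepVisibility and any vendoring of CremonaMazur2000 / AgasheStein2002 Thm 3.1 /
JetchevStein2007 Conj 7.1.1 need the notion NewformAbelianVariety A_g (Shimura1971 Thm 7.14;
Diamond–Shurman Def 6.6.3 / Thm 6.6.6) flagged by grounder g47-1 on stmt-BirchSwinnertonDyer-15489 —
filed as a definition request with this revision.

Novelty: Searches (2026-08-16): `lit search --hybrid "visibility of Shafarevich-Tate groups at higher level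
via level raising …"` (10 docs, none on
visibility); `lit search --source zbmath "visibility Shafarevich-Tate"` (11: AgasheStein2002
doi:10.1006/jnth.2002.2810, Mazur1999,
JetchevStein2007 doi:10.4171/dm/238, Agashe 2009/2021, arXiv:2601.21519, arXiv:1606.08034 …); `lit
search --source zbmath "non-vanishing
central L-values congruences between modular forms"` (1: Januszewski 2024, unrelated); `… "special
values L-functions congruences modular
forms Vatsal canonical periods"` (3: Vatsal1999, Vatsal 2013, Delbourgo–Gilmore 2021); `… "visible
factor special L-value Agashe"` (1:
Agashe2010); `… "Howard central derivatives L-functions Hida families"` (3: Howard2007, Howard 2009,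
Longo–Vigni 2014); `lit galaxy search
"visible elements of the Shafarevich-Tate group" --star pdf --mode bm25` (12, no research hit) and
`--star all` substring (0); `lit frontier
BirchSwinnertonDyer --since 2022` (25 rows; arXiv:2602.19861 uses visibility FORWARDS to produce Ш);
`lit read doi:10.4171/dm/238` pp. 2–3,
11, 16, 26–27 (Thm 4.1.1, Lemma 5.2.1, Conj 7.1.1, Rem 7.1.3: "It would be interesting to understand
the set of all levels …").
Nearest prior art found: JetchevStein2007 (doi:10.4171/dm/238) Conj 7.1.1 / Thm 5.1.3 — every
Ш-class becomes visible at SOME higher level,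
proved by one-prime level raising at depth 1; CremonaMazur2000 / AgasheStein2002 / Agashe2010 —
visibility EXPLAINS given finite Ш  [refs: 10.1006/jnth.2002.2810, 10.4171/dm/238, 10.4171/dm/238`, 2601.21519, 1606.08034, 2602.19861, doi:10.1006/jnth.2002.2810, doi:10.4171/dm/238, AgasheStein2002, Mazur1999, JetchevStein2007, Vatsal1999, Agashe2010, Howard2007, CremonaMazur2000]

Barriers (technique_class: visibility level-raising congruences nonvanishing): - technique_class: visibility level-raising congruences nonvanishing
- Literature.Barriers.BirchSwinnertonDyer.SelmerRankBarrier: the route's TARGET (its Narrow form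
says LB ⇔ Ш[p^∞]-cotorsion ⇔ existence of points); evaded in the only admissible way (scope caveat
(a): a NON-Selmer argument may establish shaCorank = 0): the distinguishing input is the
Mordell–Weil RANK OF CONGRUENT VARIETIES converted by Kato into central VANISHING of other newforms
— an observable phantom classes of E produce and honest points of E do not (points of E give Ш, not
rank, of the congruent varieties); no theorem about Sel_{p^∞}(E) alone is used for the Ш-gap.
- Literature.Barriers.BirchSwinnertonDyer.HeegnerPointBarrier: evaded by design — no point on E is
constructed; the only points are on OTHER abelian varieties A_g, forced by visibility, and the only
Euler-system input is Kato's rank-0 theorem for g; it re-enters exactly if S degrades to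
sign-changing visibility (then the explaining points are Heegner points of g and the zeros are
forced) — flagged as the failure mode of PhantomShadow.
- Literature.Barriers.BirchSwinnertonDyer.FunctionalEquationSeesOnlyParity: respected and USED: the
Fricke eigenvalue is pinned to −1 (sign +1) so that L(g,1) = 0 is information beyond the sign; no
conclusion is drawn from any functional equation.
- Literature.Barriers.BirchSwinnertonDyer.NumericalVanishingBarrier: kill criteria and the cheapest
falsifier use NON-vanishing certificates (upper certification eva

History (route lifecycle, newest last):
- 2026-08-16T15:57:13Z · rev 3: restated IsolationOfAccidentalZeros (stmt-BirchSwinnertonDyer-15488), PhantomShadow (stmt-BirchSwinnertonDyer-15489) — cone repair (rrepair, repair_kind=cone): drop import Literature.NumberTheory.EllipticCurves.CuspFormLFunction — the only module in the route's 76-module import (planner-rrepair-BirchSwinnertonDyer-ShadowIsol-9d58bc26-0)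

sub-problem: BirchSwinnertonDyer · status: open · opened planner-plan-novel-BirchSwinnertonDyer-BirchSwi-5bb0a642-c-g2-0 2026-08-16T15:10:54Z · rev 6 · ledger route-BirchSwinnertonDyer-ShadowIsolation
GENERATED by the gate from the ledger (D-0016/17). Provers cite these decls: `theorem foo : Summit.BirchSwinnertonDyer.BirchSwinnertonDyer.Theses.ShadowIsolation.<Decl> := …` in Summits/BirchSwinnertonDyer/BirchSwinnertonDyer/Theorems/<Name>.lean.
-/

namespace Summit.BirchSwinnertonDyer.BirchSwinnertonDyer.Theses.ShadowIsolation

open scoped BigOperators Topology Manifold Classical MeasureTheory ProbabilityTheory Matrix InnerProductSpace ComplexConjugate ContinuousMap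
open Filter Set Function TopologicalSpace MeasureTheory

attribute [summit_statement] _root_.BirchSwinnertonDyer

open Literature

/-- item stmt-BirchSwinnertonDyer-15487 · target · rank 0 · open · by planner
why it might fail: X ⇒ BSD-rank and Ш[p^∞]-cotorsion at EVERY such p: fails iff some E has rank ≠ r_an, or a divisible Ш[p^∞] at one good ordinary irreducible p; no engine beyond r_an ≤ 1 on either conjunct (BCS2025 Thm 1.1.2; CastellaHsieh2022 Rem 1.3).
sources: GreenbergLNM1716, Kato2004Asterisque, SkinnerUrban2014, CremonaMazur2000, JetchevStein2007
[target] for every elliptic E/ℚ (global minimal model W) and every good ordinary prime p ≥ 5 with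
E[p] irreducible: corank_{ℤ_p} Ш(E/ℚ)[p^∞] = 0 and corank Sel_{p^∞}(E/ℚ) = ord_{s=1} L(E,s). -/
@[route_item "route-BirchSwinnertonDyer-ShadowIsolation", crux]
def ShadowIsolationThesis : Prop :=
  ∀ (W : WeierstrassCurve ℚ) [W.IsElliptic] [W.IsGloballyMinimal] (p : ℕ) [Fact p.Prime], 5 ≤ p → W.HasGoodReductionAtPrime p → ¬ (p : ℤ) ∣ W.frobeniusTrace p → W.HasIrreducibleModPGaloisRep p → W.shaCorank p = 0 ∧ W.selmerCorank p = W.analyticRank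

-- earlier IsolationOfAccidentalZeros (stmt-BirchSwinnertonDyer-15488, replaced 2026-08-16T15:57:13Z -> stmt-BirchSwinnertonDyer-15786): retired by None — ∀ (W : WeierstrassCurve ℚ) [W.IsElliptic] [W.IsGloballyMinimal] (p : ℕ) [Fact p.Prime], 5 ≤ p → W.HasGoodReductionAtPrime p → ¬ (p : ℤ) ∣ W.frobeniusTrace p → W.HasIrreducibleModPGaloisRep p → ∃ n₀ : ℕ, ∀ n : ℕ, n₀ ≤ n → ¬ ∃ (M : ℕ) (_ : NeZero (W.
/-- item stmt-BirchSwinnertonDyer-15786 · crux · rank 2 · open · by planner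
why it might fail: It is a NEW non-vanishing conjecture: nothing known forbids infinitely many even-sign g_n ≡ f_E (mod p^n) of growing level N·M_n with L(g_n,1) = 0; level-aspect Maeda/orbit growth and Frey–Mazur finiteness of deep elliptic congruences are open.
sources: Vatsal1999, Howard2007, Serre1997, Shimura1977, BertoliniDarmon2005, DiamondTaylor1994
[crux] ISOLATION (card item I). For W globally minimal elliptic, p ≥ 5 good ordinary with E[p]
irreducible, there is n₀ such that for n ≥ n₀ there is NO newform g ∈ S₂(Γ₀(N_W·M)) (M squarefree,
(M, p·N_W) = 1), g not the newform of W, with Fricke eigenvalue −1 (even sign w(g) = +1), whose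
Hecke eigenvalues a_ℓ(g), ℓ ∤ N_W·M, admit a ring homomorphism ℤ[a_ℓ(g)] → ℤ/p^n sending a_ℓ(g) ↦
a_ℓ(W) (depth-n congruence), and whose L-function vanishes at the centre s = 1. Typing: re-typed
2026-08-16 (rev 3, cone repair) over Mathlib + Newforms/HeckeOperators only, same mathematical
content as stmt-BirchSwinnertonDyer-15488 (its grounder notes g47-0/g47-1 apply verbatim): `g is not
the newform of W' = its q-expansion is not (aₙ(W))ₙ (IsNewformOf unfolded); `Fricke eigenvalue −1
(sign w(g) = +1)' = w g = −g for the weight-2 double-coset operator cuspHeckeOperatorₗ of w =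
S·diag(N_W·M, 1) = (0 −1; N_W·M 0) ∈ GL₂(ℚ)⁺ (= frickeGL, and frickeInvolution in weight 2 since
N^(1−k/2) = 1; planner scratch Equiv.lean, lean check rc 0, proves frickeEigenvalue g = −1 ↔ w g =
−g for g ≠ 0); `Λ(g,1) = 0' = the L-series Σ aₙ(g) n^(−s) (re s > 2) has an entire continuation
vanishing at s = 1 (same zero: Λ = -/
@[route_item "route-BirchSwinnertonDyer-ShadowIsolation", crux]
def IsolationOfAccidentalZeros : Prop :=
  ∀ (W : WeierstrassCurve ℚ) [W.IsElliptic] [W.IsGloballyMinimal] (p : ℕ) [Fact p.Prime], 5 ≤ p → W.HasGoodReductionAtPrime p → ¬ (p : ℤ) ∣ W.frobeniusTrace p → W.HasIrreducibleModPGaloisRep p → ∃ n₀ : ℕ, ∀ n : ℕ, n₀ ≤ n → ¬ ∃ (M : ℕ) (_ : NeZero (W.conductorNorm ℤ * M)) (g : CuspForm (CongruenceSubgroup.Gamma0 (W.conductorNorm ℤ * M)) 2) (R : Subring ℂ) (φ : R →+* ZMod (p ^ n)) (hR : ∀ ℓ : ℕ, ℓ.Prime → ¬ ℓ ∣ W.conductorNorm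 ℤ * M → Literature.NumberTheory.EllipticCurves.ModularForms.heckeEigenvalue g ℓ ∈ R), Squarefree M ∧ Nat.Coprime M (p * W.conductorNorm ℤ) ∧ Literature.NumberTheory.EllipticCurves.ModularForms.IsNewform0 g ∧ (∃ m : ℕ, (UpperHalfPlane.qExpansion 1 ⇑g).coeff m ≠ ((W.LFunction m : ℤ) : ℂ)) ∧ Literature.NumberTheory.EllipticCurves.ModularForms.cuspHeckeOperatorₗ (CongruenceSubgroup.Gamma0 (W.conductorNorm ℤ * M)) 2 (Literature.NumberTheory.EllipticCurves.ModularForms.slToGLPos ModularGroup.S * Literature.NumberTheory.EllipticCurves.ModularForms.diagGL ((W.conductorNorm ℤ * M : ℕ) : ℚ) 1 (Nat.cast_pos.mpr (NeZero.pos (W.conductorNorm ℤ * M))) one_pos) g = -g ∧ (∀ (ℓ : ℕ) (hℓ : ℓ.Prime) (hℓL : ¬ ℓ ∣ W.conductorNorm ℤ * M), φ ⟨Literature.NumberTheory.EllipticCurves.ModularForms.heckeEigenvalue g ℓ, hR ℓ hℓ hℓL⟩ = ((W.frobeniusTrace ℓ : ℤ) : ZMod (p ^ n))) ∧ ∃ Λ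 : ℂ → ℂ, Differentiable ℂ Λ ∧ (∀ s : ℂ, 2 < s.re → Λ s = LSeries (fun m ↦ (UpperHalfPlane.qExpansion 1 ⇑g).coeff m) s) ∧ Λ 1 = 0

-- earlier PhantomShadow (stmt-BirchSwinnertonDyer-15489, replaced 2026-08-16T15:57:13Z -> stmt-BirchSwinnertonDyer-15787): retired by None — ∀ (W : WeierstrassCurve ℚ) [W.IsElliptic] [W.IsGloballyMinimal] (p : ℕ) [Fact p.Prime], 5 ≤ p → W.HasGoodReductionAtPrime p → ¬ (p : ℤ) ∣ W.frobeniusTrace p → W.HasIrreducibleModPGaloisRep p → ∀ n : ℕ, 1 ≤ n → (∃ σ : W.sha, addOrderOf σ = p ^ n) → ∃ (M : ℕ) (_ 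
/-- item stmt-BirchSwinnertonDyer-15787 · crux · rank 3 · open · by planner
why it might fail: Visibility of a GIVEN Ш-class is proved only for orders 2, 3 and by ONE-prime level raising a_ℓ ≡ −(ℓ+1) (JetchevStein2007 Thm 5.1.3), which can flip the sign; no sign-kept depth-n visibility theorem exists even at n = 1, and a class visible only at odd sign falsifies S.
sources: CremonaMazur2000, Mazur1999, AgasheStein2002, JetchevStein2007, Agashe2010, BertoliniDarmon2005
[crux] SHADOW (typed consequence of card items V + C1). Same W, p; for every n ≥ 1, if Ш(E/ℚ) has an
element of exact order p^n then there IS such an accidental zero at depth n: a newform g ≠ f_W of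
level N_W·M (M squarefree, coprime to p·N_W), even sign (w g = −g), depth-n congruent to W at all ℓ
∤ N_W·M, whose L-function vanishes at s = 1 (intended proof: sign-kept level raising mod p^n makes σ
visible in (E × A_g)/Δ; E[p] irreducible ⇒ rank A_g > 0 ⇒ L(g,1) = 0 by Kato Cor 14.3 — conditional
on modularity exists_isNewformOf, Ribet/Diamond–Taylor level raising, and a NewformAbelianVariety
notion A_g, none vendored yet). Typing: re-typed 2026-08-16 (rev 3, cone repair) over Mathlib +
Newforms/HeckeOperators only, same mathematical content as stmt-BirchSwinnertonDyer-15489 (its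
grounder notes g47-0/g47-1 apply verbatim): `g is not the newform of W' = its q-expansion is not
(aₙ(W))ₙ (IsNewformOf unfolded); `Fricke eigenvalue −1 (sign w(g) = +1)' = w g = −g for the weight-2
double-coset operator cuspHeckeOperatorₗ of w = S·diag(N_W·M, 1) = (0 −1; N_W·M 0) ∈ GL₂(ℚ)⁺ (=
frickeGL, and frickeInvolution in weight 2 since N^(1−k/2) = 1; planner scratch Equiv.lean, lean
check rc 0, proves f -/
@[route_item "route-BirchSwinnertonDyer-ShadowIsolation", crux]
def PhantomShadow : Prop :=
  ∀ (W : WeierstrassCurve ℚ) [W.IsElliptic] [W.IsGloballyMinimal] (p : ℕ) [Fact p.Prime], 5 ≤ p → W.HasGoodReductionAtPrime p → ¬ (p : ℤ) ∣ W.frobeniusTrace p → W.HasIrreducibleModPGaloisRep p → ∀ n : ℕ, 1 ≤ n → (∃ σ : W.sha, addOrderOf σ = p ^ n) → ∃ (M : ℕ) (_ : NeZero (W.conductorNorm ℤ * M)) (g : CuspForm (CongruenceSubgroup.Gamma0 (W.conductorNorm ℤ * M)) 2) (R : Subring ℂ) (φ : R →+* ZMod (p ^ n)) (hR : ∀ ℓ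 : ℕ, ℓ.Prime → ¬ ℓ ∣ W.conductorNorm ℤ * M → Literature.NumberTheory.EllipticCurves.ModularForms.heckeEigenvalue g ℓ ∈ R), Squarefree M ∧ Nat.Coprime M (p * W.conductorNorm ℤ) ∧ Literature.NumberTheory.EllipticCurves.ModularForms.IsNewform0 g ∧ (∃ m : ℕ, (UpperHalfPlane.qExpansion 1 ⇑g).coeff m ≠ ((W.LFunction m : ℤ) : ℂ)) ∧ Literature.NumberTheory.EllipticCurves.ModularForms.cuspHeckeOperatorₗ (CongruenceSubgroup.Gamma0 (W.conductorNorm ℤ * M)) 2 (Literature.NumberTheory.EllipticCurves.ModularForms.slToGLPos ModularGroup.S * Literature.NumberTheory.EllipticCurves.ModularForms.diagGL ((W.conductorNorm ℤ * M : ℕ) : ℚ) 1 (Nat.cast_pos.mpr (NeZero.pos (W.conductorNorm ℤ * M))) one_pos) g = -g ∧ (∀ (ℓ : ℕ) (hℓ : ℓ.Prime) (hℓL : ¬ ℓ ∣ W.conductorNorm ℤ * M), φ ⟨Literature.NumberTheory.EllipticCurves.ModularForms.heckeEigenvalue g ℓ, hR ℓ hℓ hℓL⟩ = ((W.frobeniusTrace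 ℓ : ℤ) : ZMod (p ^ n))) ∧ ∃ Λ : ℂ → ℂ, Differentiable ℂ Λ ∧ (∀ s : ℂ, 2 < s.re → Λ s = LSeries (fun m ↦ (UpperHalfPlane.qExpansion 1 ⇑g).coeff m) s) ∧ Λ 1 = 0

/-- item stmt-BirchSwinnertonDyer-0130 · crux · rank 4 · open · by planner
why it might fail: Theorem for corank ≤ 3 (r ≤ 1 converses + p-parity), OPEN from corank 4; false iff rank > r_an or Ш[p^∞] divisible at a big-image ordinary p; sole handle Kato 18.4 (corank ≤ ord_T L_p) meets Schneider's conjecture.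
sources: Kato2004Asterisque, GreenbergLNM1716, SkinnerUrban2014, arXiv:2412.20078
Upper bound half of p^∞-Selmer BSD under Skinner2020-type hypotheses. Known when corank ≤ 3 (see
#2). Kato2004 gives corank ≤ ord_T L_p, so this also follows from PAdicOrder#2. imports:
Summits.BirchSwinnertonDyer.Statement,
Literature.NumberTheory.EllipticCurves.{Selmer,Sha,Heights,GaloisAction,Tamagawa,BSDInvariants}
(routes/Sketch.lean, lean check rc 0 on 2026-08-13). -/
@[route_item "route-BirchSwinnertonDyer-ShadowIsolation", crux]
def SelmerRankUB : Prop :=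
  ∀ (W : WeierstrassCurve ℚ) [W.IsElliptic] [W.IsGloballyMinimal] (p : ℕ) [Fact p.Prime], 5 ≤ p → W.HasGoodReductionAtPrime p → ¬ (p : ℤ) ∣ W.frobeniusTrace p → W.HasSurjectiveModNGaloisRep p → W.selmerCorank p ≤ W.analyticRank

/-- item stmt-BirchSwinnertonDyer-0131 · crux · rank 5 · open · by planner
why it might fail: Theorem for r_an ≤ 3 (BCS2025: L(E,1)=0 ⇒ corank ≥ 1; corank 1 ⇒ ord 1; p-parity), OPEN from r_an = 4; needs Selmer classes out of high-order vanishing, and Heegner points are torsion once r_an ≥ 2.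
sources: SkinnerUrban2014, Kato2004Asterisque, arXiv:2412.20078, arXiv:2312.01481, WZhang2014
Lower bound half of p^∞-Selmer BSD under Skinner2020-type hypotheses. Known when r_an ≤ 3
(SkinnerUrban2014 Thm 2 corank-0 converse, Skinner2020 Thm A corank-1 converse, p-parity
DokchitserDokchitser2010). imports: Summits.BirchSwinnertonDyer.Statement,
Literature.NumberTheory.EllipticCurves.{Selmer,Sha,Heights,GaloisAction,Tamagawa,BSDInvariants}
(routes/Sketch.lean, lean check rc 0 on 2026-08-13). -/
@[route_item "route-BirchSwinnertonDyer-ShadowIsolation", crux]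
def SelmerRankLB : Prop :=
  ∀ (W : WeierstrassCurve ℚ) [W.IsElliptic] [W.IsGloballyMinimal] (p : ℕ) [Fact p.Prime], 5 ≤ p → W.HasGoodReductionAtPrime p → ¬ (p : ℤ) ∣ W.frobeniusTrace p → W.HasSurjectiveModNGaloisRep p → W.analyticRank ≤ W.selmerCorank p

/-- item stmt-BirchSwinnertonDyer-15277 · crux · rank 7 · open · by planner
why it might fail: It is Ш[p^∞]-cotorsion at an Eisenstein prime: φ-descent bounds Sel^φ by class groups/units (Greenberg–Vatsal for Iwasawa invariants) but never separates Ш_div from points once r_an ≥ 2; visibility has no grip there (rational torsion of the quotient explains it).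
sources: GreenbergVatsal2000, Mazur1978, Mazur1977, CremonaFisherONeilSimonStoll2008, Literature.Barriers.BirchSwinnertonDyer.SelmerRankBarrier
RESIDUAL EISENSTEIN SECTOR: at a good ordinary prime p ≥ 5 where E[p] is reducible (rational
p-isogeny: p ∈ {5,7,13} or finitely many j for p ∈ {11,17,19,37,43,67,163}), Ш(E/ℚ)[p^∞] is
cotorsion; the only sector where the shadow/isolation mechanism has no grip, needed because `closes`
takes its prime from the proved supply exists_good_ordinary_prime_holds. -/
@[route_item "route-BirchSwinnertonDyer-ShadowIsolation", crux]
def ShaCotorsionReducible : Prop :=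
  ∀ (W : WeierstrassCurve ℚ) [W.IsElliptic] [W.IsGloballyMinimal] (p : ℕ) [Fact p.Prime], 5 ≤ p → W.HasGoodReductionAtPrime p → ¬ (p : ℤ) ∣ W.frobeniusTrace p → ¬ W.HasIrreducibleModPGaloisRep p → W.shaCorank p = 0

/-- item stmt-BirchSwinnertonDyer-18086 · crux · rank 8 · open · by planner
why it might fail: Selmer-rank BSD for CM curves is open once min(corank_p, r_an) ≥ 2: Rubin's two-variable IMC bounds corank_p only by the order of a Katz p-adic L, whose comparison with r_an needs a non-degenerate CM p-adic height (Bertrand1982 = rank 1); r_an ≤ corank_p beyond p-parity has no engine.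
sources: Rubin1991MainConj (K. Rubin, Invent. Math. 103 (1991): two-variable main conjecture for CM curves), CoatesWiles1977; Rubin1987Sha (r_an = 0 slice), arXiv:2506.03465 (Burungale–Tian, Ann. of Math. 203 (2026) Thm 1.1: CM rank-0 p-converse) = Literature.NumberTheory.EllipticCurves.burungaleTian_analyticRank_eq_zero_of_selmerCorank_eq_zero_of_hasCM, doi:10.1007/s00222-019-00929-7 (Burungale–Tian, Invent. Math. 220 (2020): CM rank-1 p-converse, p > 3 good ordinary) = Literature.NumberTheory.EllipticCurves.burungaleTian_analyticRank_eq_one_of_selmerCorank_eq_one_of_hasCM, DokchitserDokchitserAnnals2010, Thm 1.4 (p-parity) = Literature.NumberTheory.EllipticCurves.selmerCorank_mod_two_eq, doi:10.5802/aif.2206 (Agboola–Howard, anticyclotomic Iwasawa theory of CM curves)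
[crux] CM SECTOR of SelmerRankSmallImage (stmt-BirchSwinnertonDyer-14418) — Selmer-rank BSD for
elliptic curves E/ℚ WITH COMPLEX MULTIPLICATION (globally minimal W, W.HasCM) at every prime p ≥ 5
of good ordinary reduction (the primes split in the CM field): corank_{ℤ_p} Sel_{p^∞}(E/ℚ) =
ord_{s=1} L(E,s). Filed by the route-choice planner (unit
rchoice-Summits-BirchSwinnertonDyer-Bi-aee6ff5b, 2026-08-17; payload.route_choice on
Theorems/TangentConeSelmerRankSmallImageReduction.lean, p146239, whose hypothesis
burungaleTian_analyticRank_eq_zero_of_selmerCorank_eq_zero_of_hasCM is an XL-apex non-crux fact) as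
the RE-ROUTE: with Serre's open image theorem PROVED in tree
(Literature.NumberTheory.EllipticCurves.serre_open_image_holds) every non-CM curve has a big-image
good ordinary prime q ≥ 5 (Theorems.exists_goodOrdinary_surjective_of_not_hasCM, landed), where this
route's own big-image items give corank_q = r_an, and the route's Ш item(s) transfer the corank to
any other prime through Greenberg's proved identity corank Sel_{p^∞} = rank + corank Ш[p^∞]; hence
the small-image crux costs, beyond items the route already carries, EXACTLY this statement and
NOTHING from the literature — the -/
@[route_item "route-BirchSwinnertonDyer-ShadowIsolation"]
def SelmerRankCM : Prop :=
  ∀ (W : WeierstrassCurve ℚ) [W.IsElliptic] [W.IsGloballyMinimal] (p : ℕ) [Fact p.Prime], 5 ≤ p → W.HasGoodReductionAtPrime p → ¬ (p : ℤ) ∣ W.frobeniusTrace p → W.HasCM → W.selmerCorank p = W.analyticRank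

/-- item stmt-BirchSwinnertonDyer-14418 · support · rank 6 · open · by planner
why it might fail: Open from min(corank, r_an) ≥ 2 exactly as UB/LB, and here even rank ≤ 1 is only partly known — Eisenstein p: IMC / μ = 0 only in GreenbergVatsal2000-type cases; CM: Rubin's main conjecture gives corank = ord of the Katz p-adic L, not = r_an.
sources: GreenbergVatsal2000, Mazur1978, Serre1972, SkinnerUrban2014
[crux] Complementary (small-image) sector of p^∞-Selmer BSD at ONE good ordinary prime: for E/ℚ
(globally minimal W) and p ≥ 5 of good ordinary reduction whose mod-p representation ρ̄_{E,p} is NOT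
surjective — every such p for a CM curve; for a non-CM curve the finitely many exceptional p
(Serre1972 §4.2 Thm 2), in particular the Eisenstein primes of a rational p-isogeny (Mazur1978 Thm
1: p ∈ {5,7,11,13,17,19,37,43,67,163}) and normaliser-of-Cartan images — corank_{ℤ_p} Sel_{p^∞}(E/ℚ)
= ord_{s=1} L(E,s). Together with UB ∧ LB (surjective image) this is Selmer-rank BSD at EVERY good
ordinary p ≥ 5, which is what the glue SelmerRankCruxesToThesis consumes at the prime supplied by
the PROVED tree theorem WeierstrassCurve.exists_good_ordinary_prime_holds; filed (route-choice
repair 2026-08-16) instead of a Serre-open-image prime-supply item so that the route's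
used-constants cone stays proved to Mathlib (Literature…serre_open_image is cite-only). Known:
p-parity for all E/ℚ and all p (DokchitserDokchitserAnnals2010 Thm 1.4 =
Literature.NumberTheory.EllipticCurves.selmerCorank_mod_two_eq); corank 0 ⇔ r_an 0 and corank 1 ⇔
r_an 1 in large sub-cases (irreducible non-surjective image: Buru -/
@[route_item "route-BirchSwinnertonDyer-ShadowIsolation", crux]
def SelmerRankSmallImage : Prop :=
  ∀ (W : WeierstrassCurve ℚ) [W.IsElliptic] [W.IsGloballyMinimal] (p : ℕ) [Fact p.Prime], 5 ≤ p → W.HasGoodReductionAtPrime p → ¬ (p : ℤ) ∣ W.frobeniusTrace p → ¬ W.HasSurjectiveModNGaloisRep p → W.selmerCorank p = W.analyticRank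

/-- item stmt-BirchSwinnertonDyer-15490 · support · rank 9 · closed · proved by Summit.BirchSwinnertonDyer.BirchSwinnertonDyer.Theorems.shaUnboundedOfCorank_proof @ e5fb73d2b179 (prover) · by planner
sources: Greenberg1999LNM, SilvermanAEC2009
[support] pure algebra of the tree's `zpCorank` (dim Ш[p] − dim Ш/pШ): if shaCorank W p ≠ 0 then
Ш(W) has elements of exact order p^n for every n (zpCorank ≠ 0 ⇒ Ш[p^∞][p] finite non-zero ⇒
unbounded exponent, else Ш[p^∞] finite and the two dimensions agree). [difficulty: provable-now] -/
@[route_item "route-BirchSwinnertonDyer-ShadowIsolation", crux]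
def ShaUnboundedOfCorank : Prop :=
  ∀ (W : WeierstrassCurve ℚ) [W.IsElliptic] (p : ℕ) [Fact p.Prime], W.shaCorank p ≠ 0 → ∀ n : ℕ, ∃ σ : W.sha, addOrderOf σ = p ^ n

/-- item stmt-BirchSwinnertonDyer-15491 · support · rank 9 · closed · proved by Summit.BirchSwinnertonDyer.BirchSwinnertonDyer.Theorems.primeSupplyIrreducible_proof @ 092f32ae2520 (prover) · by planner
sources: SilvermanAEC2009, Serre1981
[support] every globally minimal elliptic W/ℚ has a good ordinary prime p ≥ 5 with E[p] an
irreducible Galois module — PROVED in tree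
(`WeierstrassCurve.exists_gt_mem_goodOrdinaryPrimes_hasIrreducibleModPGaloisRep`, AEC IX.6.3 +
infinitely many ordinary primes); closable by a one-line Theorems file. [difficulty: provable-now] -/
@[route_item "route-BirchSwinnertonDyer-ShadowIsolation", crux]
def PrimeSupplyIrreducible : Prop :=
  ∀ (W : WeierstrassCurve ℚ) [W.IsElliptic] [W.IsGloballyMinimal], ∃ (p : ℕ) (_ : Fact p.Prime), 5 ≤ p ∧ W.HasGoodReductionAtPrime p ∧ ¬ (p : ℤ) ∣ W.frobeniusTrace p ∧ W.HasIrreducibleModPGaloisRep p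

/-- item stmt-BirchSwinnertonDyer-15492 · support · rank 9 · closed · proved by Summit.BirchSwinnertonDyer.BirchSwinnertonDyer.Theorems.cruxesToTarget_proof @ 5bfb3190645c (prover) · by planner
sources: GreenbergLNM1716
[support] the glue cruxes → X: Isolation → Shadow → ShaUnboundedOfCorank → SelmerRankUB →
SelmerRankLB → SelmerRankSmallImage → ShadowIsolationThesis (contrapositive: a positive Ш-corank
gives elements of all orders, Shadow gives accidental zeros at every depth, contradicting Isolation;
Selmer-BSD by the surjective / non-surjective case split). Provable now (planner Sketch.lean, rc 0).
[difficulty: provable-now] -/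
@[route_item "route-BirchSwinnertonDyer-ShadowIsolation", crux]
def CruxesToTarget : Prop :=
  IsolationOfAccidentalZeros → PhantomShadow → ShaUnboundedOfCorank → SelmerRankUB → SelmerRankLB → SelmerRankSmallImage → ShadowIsolationThesis

/-- item stmt-BirchSwinnertonDyer-17959 · support · rank 9 · closed · proved by Summit.BirchSwinnertonDyer.BirchSwinnertonDyer.Theorems.frozenTwin_serrePrimeSupply_proof @ 95fa61c19ef9 (prover) · by planner
[support] SERRE PRIME SUPPLY (literature leaf, PROVED in tree; closable today by a one-line Theorems
file): every NON-CM elliptic curve E/ℚ (global minimal model W) has a prime p ≥ 5 of good ORDINARY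
reduction at which the mod-p Galois representation is SURJECTIVE — Serre 1972 §4.2 Thm 2 (open
image) + infinitely many good ordinary primes (Serre 1981 §8). Tree proof:
Summit.BirchSwinnertonDyer.BirchSwinnertonDyer.Theorems.exists_goodOrdinary_surjective_of_not_hasCM
(Theorems/TangentConeSelmerRankSmallImageReduction.lean, p146239) =
Literature.NumberTheory.EllipticCurves.serre_open_image_holds (SerreOpenImageFinalProofs) +
WeierstrassCurve.infinite_goodOrdinaryPrimes_holds (SupersingularDensityProofs); close it with
`theorem serrePrimeSupply : <Route>.SerrePrimeSupply := fun W _ _ h =>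
Summit.BirchSwinnertonDyer.BirchSwinnertonDyer.Theorems.exists_goodOrdinary_surjective_of_not_hasCM
W h`. WHY AN ITEM (route-choice repair rchoice-de55961e, 2026-08-17): it is the PRIME SWITCH that
lets the deciding theorem consume the CM crux SelmerRankCM (stmt-BirchSwinnertonDyer-18086) instead
of SelmerRankSmallImage (stmt-14418, now support): non-CM curve → this big-image prime and the
route's own -/
@[route_item "route-BirchSwinnertonDyer-ShadowIsolation"]
def SerrePrimeSupply : Prop :=
  ∀ (W : WeierstrassCurve ℚ) [W.IsElliptic] [W.IsGloballyMinimal], ¬ W.HasCM → ∃ (p : ℕ) (_ : Fact p.Prime), 5 ≤ p ∧ W.HasGoodReductionAtPrime p ∧ ¬ (p : ℤ) ∣ W.frobeniusTrace p ∧ W.HasSurjectiveModNGaloisRep p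

/-- `SerrePrimeSupply` holds: proved by `Summit.BirchSwinnertonDyer.BirchSwinnertonDyer.Theorems.frozenTwin_serrePrimeSupply_proof` @ 95fa61c19ef9. -/
theorem SerrePrimeSupply_holds : SerrePrimeSupply := _root_.Summit.BirchSwinnertonDyer.BirchSwinnertonDyer.Theorems.frozenTwin_serrePrimeSupply_proof

/-- item stmt-BirchSwinnertonDyer-15493 · assembly · rank 1 · closed · proved by Summit.BirchSwinnertonDyer.BirchSwinnertonDyer.Theorems.shadowIsolation_assembly_proof @ 0d1f68833b96 (prover) · by planner
sources: GreenbergLNM1716, SilvermanAEC2009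
[assembly] ShadowIsolationThesis → PrimeSupplyIrreducible → BirchSwinnertonDyer (X and the prime
supply give the Statement; proved inline in `closes`). -/
@[route_item "route-BirchSwinnertonDyer-ShadowIsolation"]
def Assembly : Prop :=
  ShadowIsolationThesis → PrimeSupplyIrreducible → _root_.BirchSwinnertonDyer

/-! D-0027 §2.1 — DECIDING THEOREM (planner-authored via `route open/edit --closes-file`; by planner-rbadge-BirchSwinnertonDyer-ShadowIsola-9d58bc26-0 2026-08-16T15:30:44Z):
its hypotheses are this route's items and its conclusion the sub-problem Statement (glue_lint), and it elaborates with this file. -/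

@[closes "route-BirchSwinnertonDyer-ShadowIsolation"] theorem closes (hIso : IsolationOfAccidentalZeros) (hSh : PhantomShadow) (hUB : SelmerRankUB)
    (hLB : SelmerRankLB) (hSI : SelmerRankSmallImage) (hRed : ShaCotorsionReducible) :
    _root_.BirchSwinnertonDyer := by
  classical
  -- (A)+(B) support item `ShaUnboundedOfCorank`, PROVED inline (pure algebra of the corank formula
  -- `zpCorank A p = dim A[p] − dim A/pA`, Greenberg 1999 §1): if `shaCorank W p ≠ 0` then `Ш(W)` has an
  -- element of every exact order `p ^ n`. (A) a FINITE group has corank formula `0`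
  -- (`#ker (p•) = #A / #im (p•) = #(A/pA)` and `Nat.card = p ^ finrank`); (B) if no element of `Ш` has exact
  -- order `p ^ n` then `p ^ n` kills `Ш[p^∞]`, and `Ш[p^∞][p]` is finite (its `finrank` is positive since the
  -- corank formula is non-zero), so `Ш[p^∞] = Ш[p^∞][p^n]` is finite (`finite_torsionBy_pow`) — contradiction.
  have hzero : ∀ (B : Type) [AddCommGroup B] [Finite B] (p : ℕ) [Fact p.Prime],
      Literature.NumberTheory.EllipticCurves.zpCorank B p = 0 := by
    intro B _ _ p hp
    unfold Literature.NumberTheory.EllipticCurves.zpCorank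
    letI : Module (ZMod p) (AddSubgroup.torsionBy B (p : ℤ)) := AddSubgroup.torsionBy.zmodModule
    set φ : B →+ B := zsmulAddGroupHom (p : ℤ) with hφ
    have hker : ∀ x, x ∈ φ.ker ↔ x ∈ AddSubgroup.torsionBy B (p : ℤ) := by
      intro x
      simp [hφ, AddMonoidHom.mem_ker, Submodule.mem_torsionBy_iff]
    have hrange : ∀ x, x ∈ φ.range ↔
        x ∈ (LinearMap.range (LinearMap.lsmul ℤ B p)).toAddSubgroup := by
      intro x
      simp [hφ, AddMonoidHom.mem_range, LinearMap.mem_range]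
    have hkerEq : φ.ker = AddSubgroup.torsionBy B (p : ℤ) := AddSubgroup.ext hker
    have hrangeEq : φ.range = (LinearMap.range (LinearMap.lsmul ℤ B p)).toAddSubgroup :=
      AddSubgroup.ext hrange
    have h1 : Nat.card B = Nat.card (B ⧸ φ.ker) * Nat.card φ.ker :=
      AddSubgroup.card_eq_card_quotient_mul_card_addSubgroup _
    have h2 : Nat.card (B ⧸ φ.ker) = Nat.card φ.range :=
      Nat.card_congr (QuotientAddGroup.quotientKerEquivRange φ).toEquiv
    have h3 : Nat.card B = Nat.card (B ⧸ φ.range) * Nat.card φ.range :=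
      AddSubgroup.card_eq_card_quotient_mul_card_addSubgroup _
    have hpos : 0 < Nat.card φ.range := Nat.card_pos
    have hcard : Nat.card φ.ker = Nat.card (B ⧸ φ.range) := by
      rw [h2] at h1
      have h13 := h1.symm.trans h3
      rw [mul_comm] at h13
      exact Nat.eq_of_mul_eq_mul_right hpos h13
    have hcardK : Nat.card (AddSubgroup.torsionBy B (p : ℤ)) = Nat.card (ModN B p) := by
      rw [← hkerEq, hcard, hrangeEq]
      rfl
    haveI : Module.Finite (ZMod p) (AddSubgroup.torsionBy B (p : ℤ)) := Module.Finite.of_finite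
    haveI : Finite (ModN B p) :=
      Finite.of_surjective _ (Submodule.mkQ_surjective (LinearMap.range (LinearMap.lsmul ℤ B p)))
    haveI : Module.Finite (ZMod p) (ModN B p) := Module.Finite.of_finite
    have e1 := Module.natCard_eq_pow_finrank (K := ZMod p) (V := AddSubgroup.torsionBy B (p : ℤ))
    have e2 := Module.natCard_eq_pow_finrank (K := ZMod p) (V := ModN B p)
    rw [Nat.card_zmod] at e1 e2
    have : Module.finrank (ZMod p) (AddSubgroup.torsionBy B (p : ℤ)) =
        Module.finrank (ZMod p) (ModN B p) :=
      Nat.pow_right_injective hp.out.two_le (e1.symm.trans (hcardK.trans e2))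
    omega
  have hAlg : ShaUnboundedOfCorank := by
    intro W _ p hp hcor n
    have hpp : p.Prime := hp.out
    by_contra hno
    push Not at hno
    apply hcor
    -- the `p`-primary part `A = Ш[p^∞]` of `Ш(W)`
    set A : AddSubgroup ↥W.sha := AddCommGroup.primaryComponent (↥W.sha) p
    show Literature.NumberTheory.EllipticCurves.zpCorank (↥A) p = 0
    -- (B1) `p ^ n` kills `A`: an element of order `p ^ m`, `m ≥ n`, would have a multiple of exact order `p ^ n`
    have hkill : ∀ a : ↥A, p ^ n • a = 0 := by
      intro a
      obtain ⟨k, hk⟩ : ∃ k : ℕ, p ^ k • (a : ↥W.sha) = 0 := a.2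
      have hdvd : addOrderOf (a : ↥W.sha) ∣ p ^ k := addOrderOf_dvd_of_nsmul_eq_zero hk
      obtain ⟨m, -, hm⟩ := (Nat.dvd_prime_pow hpp).1 hdvd
      by_cases hmn : n ≤ m
      · exfalso
        have hne : addOrderOf (a : ↥W.sha) ≠ 0 := by rw [hm]; exact pow_ne_zero _ hpp.ne_zero
        have hdiv : p ^ n ∣ addOrderOf (a : ↥W.sha) := by rw [hm]; exact pow_dvd_pow p hmn
        exact hno _ (addOrderOf_nsmul_addOrderOf_sub hne hdiv)
      · push Not at hmn
        have hdiv : addOrderOf (a : ↥W.sha) ∣ p ^ n := by rw [hm]; exact pow_dvd_pow p hmn.le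
        apply Subtype.ext
        rw [AddSubgroupClass.coe_nsmul, ZeroMemClass.coe_zero]
        exact addOrderOf_dvd_iff_nsmul_eq_zero.mp hdiv
    -- (B2) `A[p]` is finite: otherwise its `finrank` is the junk value `0` and the corank formula is `0`
    haveI hfinp : Finite ↥(AddSubgroup.torsionBy (↥A) (p : ℤ)) := by
      by_contra hinf
      apply hcor
      show Literature.NumberTheory.EllipticCurves.zpCorank (↥A) p = 0
      unfold Literature.NumberTheory.EllipticCurves.zpCorank
      letI : Module (ZMod p) (AddSubgroup.torsionBy (↥A) (p : ℤ)) := AddSubgroup.torsionBy.zmodModule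
      have h0 : Module.finrank (ZMod p) (AddSubgroup.torsionBy (↥A) (p : ℤ)) = 0 := by
        apply Module.finrank_of_not_finite
        intro hf
        exact hinf (Module.finite_of_finite (ZMod p))
      rw [h0, Nat.zero_sub]
    -- (B3) hence `A = A[p^n]` is finite and (A) applies
    haveI : Finite ↥(AddSubgroup.torsionBy (↥A) ((p ^ n : ℕ) : ℤ)) :=
      Literature.NumberTheory.EllipticCurves.finite_torsionBy_pow (↥A) p n
    haveI : Finite ↥A :=
      Finite.of_injective
        (fun a : ↥A => (⟨a, AddSubgroup.torsionBy.nsmul_iff.mpr (hkill a)⟩ :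
          ↥(AddSubgroup.torsionBy (↥A) ((p ^ n : ℕ) : ℤ))))
        (fun a b h => by simpa using congrArg Subtype.val h)
    exact hzero (↥A) p
  -- support item `CruxesToTarget` (the glue cruxes → X), proved inline: Ш-cotorsion by contradiction
  -- (positive corank ⇒ Ш-elements of every order p^n ⇒ accidental zeros at every depth, against isolation),
  -- Selmer-BSD by the surjective / non-surjective case split
  have hG : CruxesToTarget := by
    intro hIso hSh hAlg hUB hLB hSI W _ _ p _ h5 hgood hord hirr
    refine ⟨?_, ?_⟩
    · by_contra hne
      obtain ⟨n₀, hn₀⟩ := hIso W p h5 hgood hord hirr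
      obtain ⟨σ, hσ⟩ := hAlg W p hne (max n₀ 1)
      exact hn₀ (max n₀ 1) (le_max_left _ _)
        (hSh W p h5 hgood hord hirr (max n₀ 1) (le_max_right _ _) ⟨σ, hσ⟩)
    · by_cases hsurj : W.HasSurjectiveModNGaloisRep p
      · exact le_antisymm (hUB W p h5 hgood hord hsurj) (hLB W p h5 hgood hord hsurj)
      · exact hSI W p h5 hgood hord hsurj
  have hT : ShadowIsolationThesis := hG hIso hSh hAlg hUB hLB hSI
  -- Greenberg's corank identity `corank Sel_{p^∞} = rank + corank Ш[p^∞]`, discharged in tree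
  have hId : ∀ (W : WeierstrassCurve ℚ) [W.IsElliptic] (p : ℕ) [Fact p.Prime],
      W.selmerCorank p = W.mordellWeilRank + W.shaCorank p :=
    fun W _ p _ => W.selmerCorank_eq_mordellWeilRank_add_holds p
  -- (T1) the Mordell–Weil rank is an isomorphism invariant (AEC III.3.1(b); `VariableChangePoints`)
  have hMW : ∀ (W : WeierstrassCurve ℚ) (C : WeierstrassCurve.VariableChange ℚ),
      (C • W).mordellWeilRank = W.mordellWeilRank := fun W C =>
    @WeierstrassCurve.VariableChange.finrank_point_variableChange ℚ _ W C (Classical.decEq ℚ)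
  -- (T2) the local Euler factor over the fraction field of a DVR is an isomorphism invariant
  -- (AEC VII.1.3(b), VII.2, VII.5.1, App. C §16), as in route SelmerRank's certified `closes`
  have hloc : ∀ (R : Type) [CommRing R] [IsDomain R] [IsDiscreteValuationRing R]
      (K : Type) [Field K] [Algebra R K] [IsFractionRing R K]
      (W : WeierstrassCurve K) [W.IsElliptic] (C : WeierstrassCurve.VariableChange K),
      (C • W).localEulerFactor R = W.localEulerFactor R := by
    intro R _ _ _ K _ _ _ W _ C
    obtain ⟨D, hD⟩ : ∃ D : WeierstrassCurve.VariableChange K,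
        (C • W).minimal R = D • W.minimal R :=
      ⟨((C • W).exists_isMinimal R).choose * C * ((W.exists_isMinimal R).choose)⁻¹, by
        rw [WeierstrassCurve.minimal, WeierstrassCurve.minimal, mul_smul, mul_smul, inv_smul_smul]⟩
    haveI hE : (W.minimal R).IsElliptic := by rw [WeierstrassCurve.minimal]; infer_instance
    have hΔ : (W.minimal R).Δ ≠ 0 := (W.minimal R).isUnit_Δ.ne_zero
    have hgood : ((C • W).minimal R).HasGoodReduction R ↔ (W.minimal R).HasGoodReduction R := by
      rw [WeierstrassCurve.hasGoodReduction_iff, WeierstrassCurve.hasGoodReduction_iff,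
        WeierstrassCurve.valuation_Δ_eq_of_isMinimal_of_eq_smul R hD]
      exact and_congr_left' ⟨fun _ => inferInstance, fun _ => inferInstance⟩
    have hcard : Nat.card (((C • W).minimal R).reduction R).toAffine.Point =
        Nat.card ((W.minimal R).reduction R).toAffine.Point := by
      obtain ⟨E, hE⟩ := WeierstrassCurve.exists_reduction_eq_smul R hD hΔ
      rw [hE]
      exact WeierstrassCurve.natCard_point_smul _ _
    have hpoly : (C • W).localPolynomial R = W.localPolynomial R := by
      classical
      unfold WeierstrassCurve.localPolynomial
      simp only [hgood, hcard,
        WeierstrassCurve.hasSplitMultiplicativeReduction_iff_of_isMinimal_of_eq_smul R hD hΔ,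
        WeierstrassCurve.hasMultiplicativeReduction_iff_of_isMinimal_of_eq_smul R hD hΔ]
    simp only [WeierstrassCurve.localEulerFactor, WeierstrassCurve.localPowerSeries, hpoly]
  -- (T3) hence the analytic rank `ord_{s=1} L(E,s)` is an isomorphism invariant (AEC App. C §16)
  have hAn : ∀ (W : WeierstrassCurve ℚ) [W.IsElliptic] (C : WeierstrassCurve.VariableChange ℚ),
      (C • W).analyticRank = W.analyticRank := by
    intro W _ C
    have hL : (C • W).LFunction = W.LFunction := by
      unfold WeierstrassCurve.LFunction
      congr 1
      funext v
      simp only [WeierstrassCurve.baseChange, ← WeierstrassCurve.map_variableChange]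
      exact hloc _ _ _ _
    have hLS : (C • W).LSeries = W.LSeries := by
      funext s
      simp only [WeierstrassCurve.LSeries, hL]
    have hEC : (C • W).entireContinuations = W.entireContinuations := by
      simp only [WeierstrassCurve.entireContinuations, hLS]
    have hEL : (C • W).entireLFunction = W.entireLFunction := by
      unfold WeierstrassCurve.entireLFunction
      rw [hEC, hLS]
    simp only [WeierstrassCurve.analyticRank, hEL]
  -- ASSEMBLY (X, R and the Selmer cruxes → the Statement), proved inline:
  -- BirchSwinnertonDyer := Literature.BSDRankConjecture := ∀ W, W.IsElliptic → r_an W = r_MW W;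
  -- pass to a global minimal model `C • W`, take the PROVED supply of a good ordinary prime `p ≥ 5`
  -- (`exists_good_ordinary_prime_holds`, OrdinaryPrimesProofs); if `E[p]` is irreducible apply X, else
  -- R (`ShaCotorsionReducible`) and the image dichotomy (UB ∧ LB, or SmallImage); conclude by Greenberg's
  -- corank identity and transport back along `C`
  intro W hW
  obtain ⟨C, hC⟩ := WeierstrassCurve.hasGlobalMinimalModel_rat_holds W
  obtain ⟨p, hp, h5, hgood, hord⟩ := WeierstrassCurve.exists_good_ordinary_prime_holds (C • W)
  have h2 : (C • W).selmerCorank p = (C • W).mordellWeilRank + (C • W).shaCorank p := hId (C • W) p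
  have h6 := hMW W C
  have h7 := hAn W C
  by_cases hirr : (C • W).HasIrreducibleModPGaloisRep p
  · obtain ⟨hsha, hsel⟩ := hT (C • W) p h5 hgood hord hirr
    omega
  · have hsha : (C • W).shaCorank p = 0 := hRed (C • W) p h5 hgood hord hirr
    have hsel : (C • W).selmerCorank p = (C • W).analyticRank := by
      by_cases hsurj : (C • W).HasSurjectiveModNGaloisRep p
      · exact le_antisymm (hUB (C • W) p h5 hgood hord hsurj) (hLB (C • W) p h5 hgood hord hsurj)
      · exact hSI (C • W) p h5 hgood hord hsurj
    omega

end Summit.BirchSwinnertonDyer.BirchSwinnertonDyer.Theses.ShadowIsolation
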